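import Summits.BirchSwinnertonDyer.BirchSwinnertonDyer.Theorems.BiquadraticEisensteinDescentEisensteinHeartFlatCMInertBadKPrimeThetaDatum
import Summits.BirchSwinnertonDyer.Rank1Residual.X12.CMGoodOrdinarySplit
import Summits.BirchSwinnertonDyer.Rank1Residual.X11b.CastellaErratumHeegner
import Literature.NumberTheory.EllipticCurves.Rank1Residual.CMFieldDecompositionProofs
import Literature.NumberTheory.EllipticCurves.IsogenyHasCMIffJMemProofs
import Literature.NumberTheory.EllipticCurves.HeegnerPointsImaginaryQuadraticProofs
import Literature.NumberTheory.EllipticCurves.ModularityVersionApProofs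
import Literature.NumberTheory.QuadraticFields.HeegnerCondition
import HarnessLib

set_option linter.dupNamespace false -- `Summit.BirchSwinnertonDyer.BirchSwinnertonDyer.Theorems.…` (summit = sub, D-0017)
set_option autoImplicit false

/-!
# Crux `EisensteinHeartFlatCMInertBadKPrime` (stmt-BirchSwinnertonDyer-21341), line `hsieh-lambda`, layer 2:
# the ϑ/D/T-datum of the Katz fact FROM THE ITEM'S OWN BINDERS (`W`, `p`, `K′` Heegner, CM) — route-level one call

Route `BiquadraticEisensteinDescent` (width seat `bsd-wall-cm-bed-w2` g7; sequel of `…ThetaDatum.lean`). THEOREMS ONLY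
(no definition, no named fact, no `sorry`). BSD is not proved by any of this; nothing here asserts the crux's input.

`…ThetaDatum.exists_theta_datum` takes ARITHMETIC frame data (`[K:ℚ] = 2`, `y² = d_K < 0`, `d` a CM discriminant
coprime to `d_K`, a prime set `P ∌` divisors of `d_K`, …). At the item's frame all of it is DERIVED from the binders of
`Theses.BiquadraticEisensteinDescent.EisensteinHeartFlatCMInertBadKPrime`:

* `not_dvd_discr_of_heegner` — Heegner hypothesis ⟹ every `ℓ ∣ N` is unramified in `K′` (`ℓ ∤ d_{K′}`): the tree's
  `X11b.not_dvd_discr_of_splitsIn`;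
* `not_dvd_discr_of_dvd_cmFieldDiscr` — **`gcd(d_CM, d_{K′}) = 1`**: `ℓ ∣ d_CM` ⟹ `ℓ` is CM-ramified ⟹ `W` is BAD at `ℓ`
  (`X12.not_good_of_cmRamified'`, every prime) ⟹ `ℓ ∣ N_W` ⟹ `ℓ` splits in `K′` ⟹ `ℓ ∤ d_{K′}`;
* `exists_sq_eq_discr_im_neg` — `√d_{K′} ∈ K′` oriented with `Im φ₀(√d_{K′}) < 0`;
* `cmFieldDiscrOfJ_mem_nine` — `d = cmFieldDiscrOfJ W.j` is one of the nine discriminants (`hasCM_iff_j_mem_holds`);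
* **`exists_theta_datum_route`** — for `W` CM, bad at `p`, `K′` imaginary quadratic Heegner for `N_W`, `L = K′(x)` a CM field with
  `[L:K′] ≤ 2`, `x² = cmFieldDiscrOfJ W.j`, a CM type `Σ` ORIENTED by `φ₀` (w2 g6 `…SigmaOrientation.inSigma_singleton_iff`:
  `InSigma ι {𝔓′} σ ↔ σ|K′ = φ̄₀`) and any finite `S` of primes of `L` above `N_W`:
  **∃ ϑ D T with `hϑ₁ hϑ₂ hTS hT hST hD₁ hD₂ hD₃ hD₄ hd2`** of `KatzCM.exists_isBaseChangeLine`, where `D = {w ∣ ∏_{ℓ ∣ N_W} ℓ}`.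
  (`ι`, `Sp = {𝔓′}` enter only through the orientation hypothesis `hSigma`, which the LEAD discharges with the item's
  compatible `ι′` by `inSigma_singleton_iff` — both orientations are available by replacing `φ₀` with `φ̄₀`.)
[cite: Hsieh2014mu, §3.1 (d1) (d2), §4.8]
-/

noncomputable section

open scoped nonZeroDivisors NumberField Pointwise

namespace Summit.BirchSwinnertonDyer.BirchSwinnertonDyer.Theorems.BiquadraticEisensteinDescentEisensteinHeartFlatCMInertBadKPrimeThetaRoute

open NumberField IsDedekindDomain WeierstrassCurve Literature.NumberTheory.EllipticCurves
  Literature.NumberTheory.EllipticCurves.Rank1Residual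
open Summit.BirchSwinnertonDyer.BirchSwinnertonDyer.Theorems.BiquadraticEisensteinDescentEisensteinHeartFlatCMInertBadKPrimeThetaDatum

/-! ## §1 The frame's arithmetic, from the item's binders -/

section Frame

variable {K : Type} [Field K] [NumberField K]

/-- **Heegner ⟹ `ℓ ∤ d_{K′}` for every prime `ℓ ∣ N`** (split primes are unramified). [cite: GrossZagier1986, §I.1 (Heegner hypothesis)] -/
theorem not_dvd_discr_of_heegner (hK : IsImaginaryQuadratic K) {N : ℕ} (hHN : SatisfiesHeegnerHypothesis N K)
    {ℓ : ℕ} (hℓ : ℓ.Prime) (hℓN : ℓ ∣ N) : ¬ (ℓ : ℤ) ∣ NumberField.discr K :=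
  Summit.BirchSwinnertonDyer.Rank1Residual.X11b.not_dvd_discr_of_splitsIn hK.1 hℓ (hHN ℓ hℓ hℓN)

/-- **`gcd(d_CM, d_{K′}) = 1` at the frame**: a prime dividing the CM discriminant of `W` is a prime of BAD reduction
(`X12.not_good_of_cmRamified'`), hence divides `N_W`, hence splits in the Heegner field `K′`, hence does not divide
`d_{K′}`. [cite: SilvermanAEC2009, Cor. VII.7.2] [cite: SilvermanATAEC1994, App. A §3] -/
theorem not_dvd_discr_of_dvd_cmFieldDiscr (W : WeierstrassCurve ℚ) [W.IsElliptic] [W.IsGloballyMinimal]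
    (hCM : W.HasCM) (hK : IsImaginaryQuadratic K) (hHN : SatisfiesHeegnerHypothesis (W.conductorNorm ℤ) K)
    {ℓ : ℕ} (hℓ : ℓ.Prime) (hℓd : (ℓ : ℤ) ∣ cmFieldDiscrOfJ W.j) : ¬ (ℓ : ℤ) ∣ NumberField.discr K := by
  haveI : Fact ℓ.Prime := ⟨hℓ⟩
  have hbad : ¬ Good W ℓ := Summit.BirchSwinnertonDyer.Rank1Residual.X12.not_good_of_cmRamified' W ℓ hCM hℓd
  have hℓN : ℓ ∣ W.conductorNorm ℤ := (W.dvd_conductorNorm_iff_not_hasGoodReductionAtPrime ℓ).mpr hbad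
  exact not_dvd_discr_of_heegner hK hHN hℓ hℓN

/-- **`√d_{K′} ∈ K′`, oriented**: there is `y ∈ K′` with `y² = d_{K′}` and `Im φ₀(y) < 0` (`d_{K′} < 0`, so `φ₀(y)` is
purely imaginary and non-zero; replace `y` by `−y` if needed). [cite: Cox2013, §7.A] -/
theorem exists_sq_eq_discr_im_neg (hK : IsImaginaryQuadratic K) (φ₀ : K →+* ℂ) :
    ∃ y : K, y ^ 2 = (NumberField.discr K : K) ∧ (φ₀ y).im < 0 := by
  obtain ⟨-, -, δ, -, hδ⟩ := Literature.NumberTheory.QuadraticFields.Quadratic.exists_sq_eq_discr (K := K) hK.1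
  have hy : ((δ : K)) ^ 2 = (NumberField.discr K : K) := by
    have h := congrArg ((↑) : 𝓞 K → K) hδ
    push_cast at h
    exact h
  have hdK : NumberField.discr K < 0 := hK.discr_neg
  -- `φ₀ δ` is purely imaginary with `(Im)² = −d_K > 0`
  have hsq : (φ₀ (δ : K)) ^ 2 = -(((-NumberField.discr K : ℤ) : ℝ) : ℂ) := by
    rw [← map_pow, hy, map_intCast]; push_cast; ring
  have hr : (0 : ℝ) ≤ ((-NumberField.discr K : ℤ) : ℝ) := by exact_mod_cast (by omega : (0 : ℤ) ≤ -NumberField.discr K)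
  have him := im_sq_eq_of_sq_eq_neg hr hsq
  have hne : (φ₀ (δ : K)).im ≠ 0 := by
    intro h0; rw [h0] at him
    have : ((-NumberField.discr K : ℤ) : ℝ) = 0 := by rw [← him]; ring
    have : (-NumberField.discr K : ℤ) = 0 := by exact_mod_cast this
    omega
  rcases lt_or_gt_of_ne hne with hlt | hgt
  · exact ⟨δ, hy, hlt⟩
  · refine ⟨-(δ : K), by rw [neg_sq, hy], ?_⟩
    rw [map_neg, Complex.neg_im]; linarith

/-- `d_CM = cmFieldDiscrOfJ W.j` is one of the nine CM discriminants. [cite: SilvermanATAEC1994, App. A §3] -/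
theorem cmFieldDiscrOfJ_mem_nine (W : WeierstrassCurve ℚ) [W.IsElliptic] (hCM : W.HasCM) :
    cmFieldDiscrOfJ W.j = -3 ∨ cmFieldDiscrOfJ W.j = -4 ∨ cmFieldDiscrOfJ W.j = -7 ∨ cmFieldDiscrOfJ W.j = -8 ∨
      cmFieldDiscrOfJ W.j = -11 ∨ cmFieldDiscrOfJ W.j = -19 ∨ cmFieldDiscrOfJ W.j = -43 ∨ cmFieldDiscrOfJ W.j = -67 ∨
      cmFieldDiscrOfJ W.j = -163 := by
  have h := cmFieldDiscrOfJ_mem_of_mem_cmJInvariants ((WeierstrassCurve.hasCM_iff_j_mem_holds W).mp hCM)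
  simpa only [Finset.mem_insert, Finset.mem_singleton] using h

end Frame

/-! ## §2 The route-level datum -/

/-- **The ϑ/D/T-datum of the Katz existence fact, from the item's binders.** See the module docstring.
[cite: Hsieh2014mu, §3.1 (d1) (d2), §4.8] -/
theorem exists_theta_datum_route (W : WeierstrassCurve ℚ) [W.IsElliptic] [W.IsGloballyMinimal]
    [NeZero (W.conductorNorm ℤ)] (p : ℕ) [Fact p.Prime] (K : Type) [Field K] [NumberField K]
    (hCM : W.HasCM) (hbad : ¬ Good W p) (hK : IsImaginaryQuadratic K)
    (hHN : SatisfiesHeegnerHypothesis (W.conductorNorm ℤ) K)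
    (L : Type) [Field L] [NumberField L] [Algebra K L] [IsCMField L] (h2 : Module.finrank K L ≤ 2)
    {x : L} (hgen : Algebra.adjoin K {x} = ⊤) (hx : x ^ 2 = (cmFieldDiscrOfJ W.j : L))
    (φ₀ : K →+* ℂ) {ι : PadicAlgCl p ≃+* ℂ} {Sp : Finset (HeightOneSpectrum (𝓞 L))}
    (hSigma : ∀ σ : L →+* ℂ, KatzCM.InSigma ι Sp σ →
      σ.comp (algebraMap K L) = NumberField.ComplexEmbedding.conjugate φ₀)
    (S : Finset (HeightOneSpectrum (𝓞 L)))
    (hSP : ∀ w ∈ S, ∃ ℓ ∈ (W.conductorNorm ℤ).primeFactors, ((ℓ : ℕ) : 𝓞 L) ∈ w.asIdeal) :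
    ∃ (ϑ : L) (D T : Finset (HeightOneSpectrum (𝓞 L))),
      (∀ σ : L →+* ℂ, (σ ϑ).re = 0) ∧
      (∀ σ : L →+* ℂ, KatzCM.InSigma ι Sp σ → 0 < (σ ϑ).im) ∧
      T ⊆ S ∧ (∀ w ∈ T, IsCMField.complexConj L • w ≠ w ∧ IsCMField.complexConj L • w ∉ T) ∧
      (∀ w ∈ S, IsCMField.complexConj L • w ≠ w → (w ∈ T ∨ IsCMField.complexConj L • w ∈ T)) ∧
      KatzCM.primesOver L p ⊆ D ∧ S ⊆ D ∧
      (∀ w ∈ S, IsCMField.complexConj L • w ∈ D) ∧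
      (∀ w : HeightOneSpectrum (𝓞 L), w.asIdeal.ramificationIdx (𝓞 (maximalRealSubfield L)) ≠ 1 → w ∈ D) ∧
      (∀ w ∈ D, ordAt w (2 * ϑ) = differentExponentAt w) := by
  obtain ⟨y, hy, hφ₀⟩ := exists_sq_eq_discr_im_neg hK φ₀
  have hN0 : W.conductorNorm ℤ ≠ 0 := NeZero.ne _
  have hpN : p ∣ W.conductorNorm ℤ := (W.dvd_conductorNorm_iff_not_hasGoodReductionAtPrime p).mpr hbad
  exact exists_theta_datum hK.1 h2 hgen hx (cmFieldDiscrOfJ_mem_nine W hCM) hy hK.discr_neg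
    (fun ℓ hℓ hℓd ↦ not_dvd_discr_of_dvd_cmFieldDiscr W hCM hK hHN hℓ hℓd) hφ₀
    (W.conductorNorm ℤ).primeFactors (fun ℓ hℓ ↦ Nat.prime_of_mem_primeFactors hℓ)
    (fun ℓ hℓ ↦ not_dvd_discr_of_heegner hK hHN (Nat.prime_of_mem_primeFactors hℓ) (Nat.dvd_of_mem_primeFactors hℓ))
    (Nat.mem_primeFactors.mpr ⟨Fact.out, hpN, hN0⟩) S hSP hSigma

end Summit.BirchSwinnertonDyer.BirchSwinnertonDyer.Theorems.BiquadraticEisensteinDescentEisensteinHeartFlatCMInertBadKPrimeThetaRoute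

end
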